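import Literature.NumberTheory.EllipticCurves.SemistableModPImageIrreducibleProofs
import Literature.NumberTheory.EllipticCurves.SerreOpenImageDeterminantProofs
import HarnessLib

/-!
# A non-trivial commutator of the mod-`3` image is `−I` or has square `−I` — step (A2) of the split prime-conductor
# Chebotarev–Kummer supply (c′)
# (cell `bsd-stepL`, seat `bsd-stepL-corner3-p2` g15 = lane B, LINE OWNER of crux 21420 `CornerAtThreeW`; `--supports stmt-BirchSwinnertonDyer-21420 --as helper`)

WHY. Conjunct (c′) of the r18/r19 residual stub of `Cruxes/CornerAtThreeW/Lines/inert.lean` (ONE split prime-conductor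
Chebotarev–Kummer supply; lane B g14 memo CORNER3-G14 §6–§7) is proved by Chebotarev's theorem applied to a WITNESS `γ ∈ Γ_K`
acting as `−I` on `E[3]`, trivially on the ring class field `K[m₀]` and on `μ_{3^E}`, and non-trivially on a cube root. The
witness is built from COMMUTATORS of `Γ_K` (they act trivially on every abelian extension of `K`). THIS FILE is the
finite-group step: for `E = W/ℚ` with `E[3]` irreducible and `ρ̄_{E,3}` NOT onto (so `3 ∤ #ρ̄_{E,3}(Γ_ℚ)`, Serre 1972 Prop. 15,
tree `not_dvd_card_of_not_hasSurjectiveModNGaloisRep`), and `a, b ∈ Γ_ℚ` whose images do not commute, the commutator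
`c = a b a⁻¹ b⁻¹` acts on `E[3]` either as `−1` or with `c²` acting as `−1`
(`smul_eq_neg_or_sq_smul_eq_neg_of_commutator`). Group theory: `A = Φ(ρ̄ c) ∈ SL₂(𝔽₃)`, `A ≠ 1`, and `A` has order prime to `3`;
Cayley–Hamilton by trace: `tr A = 0 ⟹ A² = −1`; `tr A = 1 ⟹ A³ = −1`, so `A²` has order dividing `3`, hence `A² = 1` and
`A = A³ = −1`; `tr A = −1 ⟹ A³ = 1`, order `3` — excluded (`eq_neg_one_or_sq_eq_neg_one_of_det_eq_one`).
HONEST FRAMING: THEOREMS ONLY (no definition, no named fact, no `sorry`); nothing about any CM point or any crux object; no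
stub ∕ item closes; 21420 OPEN; no census label moves (T7); BSD is proved for no curve.
References (locators only): [cite: Serre1972, §2.4 Prop. 15, §2.5–2.6, §5.4 (proof of Prop. 21)].
presearch: in-tree (`SemistableModPImageIrreducibleProofs`, `SerreOpenImageDeterminantProofs`, lane B g13
`…FrobeniusTraceTwoModThree` §1 for the entry-wise `decide` technique). Axioms: `propext`, `Classical.choice`, `Quot.sound`.
-/

set_option autoImplicit false
set_option linter.dupNamespace false

noncomputable section

open scoped Classical NumberField

namespace Summit.BirchSwinnertonDyer.BirchSwinnertonDyer.Theorems.ChebKummerThree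

open Matrix WeierstrassCurve NumberField Field
  Literature.NumberTheory.GaloisRepresentations Literature.NumberTheory.EllipticCurves

/-! ### §1. `SL₂(𝔽₃)`: Cayley–Hamilton by trace, entry-wise (`3⁴` cases each, kernel `decide`) -/

/-- `det A = 1`, `tr A = 0` ⟹ `A² = −1`, entry by entry over `𝔽₃`. [cite: Serre1972, §2.5] -/
private theorem entries_sq_of_det_eq_one_of_trace_eq_zero :
    ∀ a b c d : ZMod 3, a * d - b * c = 1 → a + d = 0 →
      a * a + b * c = -1 ∧ a * b + b * d = 0 ∧ c * a + d * c = 0 ∧ c * b + d * d = -1 := by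
  decide

/-- `det A = 1`, `tr A = 1` ⟹ `A³ = −1`, entry by entry over `𝔽₃` (`A² = A − 1`, `A³ = A² − A = −1`). [cite: Serre1972, §2.5] -/
private theorem entries_cube_of_det_eq_one_of_trace_eq_one :
    ∀ a b c d : ZMod 3, a * d - b * c = 1 → a + d = 1 →
      (a * a + b * c) * a + (a * b + b * d) * c = -1 ∧ (a * a + b * c) * b + (a * b + b * d) * d = 0 ∧
      (c * a + d * c) * a + (c * b + d * d) * c = 0 ∧ (c * a + d * c) * b + (c * b + d * d) * d = -1 := by
  decide

/-- `det A = 1`, `tr A = −1` ⟹ `A³ = 1`, entry by entry over `𝔽₃` (`A² = −A − 1`, `A³ = 1`). [cite: Serre1972, §2.5] -/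
private theorem entries_cube_of_det_eq_one_of_trace_eq_two :
    ∀ a b c d : ZMod 3, a * d - b * c = 1 → a + d = 2 →
      (a * a + b * c) * a + (a * b + b * d) * c = 1 ∧ (a * a + b * c) * b + (a * b + b * d) * d = 0 ∧
      (c * a + d * c) * a + (c * b + d * d) * c = 0 ∧ (c * a + d * c) * b + (c * b + d * d) * d = 1 := by
  decide

/-- In `GL₂(𝔽₃)`: `det A = 1` and `tr A = 0` give `A² = −1`. [cite: Serre1972, §2.5–2.6] -/
theorem sq_eq_neg_one_of_det_eq_one_of_trace_eq_zero {A : GL (Fin 2) (ZMod 3)}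
    (hdet : Matrix.det (A : Matrix (Fin 2) (Fin 2) (ZMod 3)) = 1)
    (htr : Matrix.trace (A : Matrix (Fin 2) (Fin 2) (ZMod 3)) = 0) : A ^ 2 = -1 := by
  set M : Matrix (Fin 2) (Fin 2) (ZMod 3) := (A : Matrix (Fin 2) (Fin 2) (ZMod 3)) with hM
  rw [Matrix.det_fin_two] at hdet
  rw [Matrix.trace_fin_two] at htr
  obtain ⟨h00, h01, h10, h11⟩ :=
    entries_sq_of_det_eq_one_of_trace_eq_zero (M 0 0) (M 0 1) (M 1 0) (M 1 1) hdet htr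
  apply Units.ext
  rw [Units.val_pow_eq_pow_val, Units.val_neg, Units.val_one, sq, ← hM]
  ext i j
  fin_cases i <;> fin_cases j <;>
    simp only [Matrix.mul_apply, Fin.sum_univ_two, Matrix.neg_apply, Matrix.one_apply, Fin.isValue, Fin.zero_eta, Fin.mk_one,
      if_true, one_ne_zero, zero_ne_one, if_false, neg_zero] <;>
    first | exact h00 | exact h01 | exact h10 | exact h11

/-- In `GL₂(𝔽₃)`: `det A = 1` and `tr A = 1` give `A³ = −1`. [cite: Serre1972, §2.5–2.6] -/
theorem cube_eq_neg_one_of_det_eq_one_of_trace_eq_one {A : GL (Fin 2) (ZMod 3)}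
    (hdet : Matrix.det (A : Matrix (Fin 2) (Fin 2) (ZMod 3)) = 1)
    (htr : Matrix.trace (A : Matrix (Fin 2) (Fin 2) (ZMod 3)) = 1) : A ^ 3 = -1 := by
  set M : Matrix (Fin 2) (Fin 2) (ZMod 3) := (A : Matrix (Fin 2) (Fin 2) (ZMod 3)) with hM
  rw [Matrix.det_fin_two] at hdet
  rw [Matrix.trace_fin_two] at htr
  obtain ⟨h00, h01, h10, h11⟩ :=
    entries_cube_of_det_eq_one_of_trace_eq_one (M 0 0) (M 0 1) (M 1 0) (M 1 1) hdet htr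
  apply Units.ext
  rw [Units.val_pow_eq_pow_val, Units.val_neg, Units.val_one, pow_succ, sq, ← hM]
  ext i j
  fin_cases i <;> fin_cases j <;>
    simp only [Matrix.mul_apply, Fin.sum_univ_two, Matrix.neg_apply, Matrix.one_apply, Fin.isValue, Fin.zero_eta, Fin.mk_one,
      if_true, one_ne_zero, zero_ne_one, if_false, neg_zero] <;>
    first | exact h00 | exact h01 | exact h10 | exact h11

/-- In `GL₂(𝔽₃)`: `det A = 1` and `tr A = −1` give `A³ = 1`. [cite: Serre1972, §2.5–2.6] -/
theorem cube_eq_one_of_det_eq_one_of_trace_eq_two {A : GL (Fin 2) (ZMod 3)}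
    (hdet : Matrix.det (A : Matrix (Fin 2) (Fin 2) (ZMod 3)) = 1)
    (htr : Matrix.trace (A : Matrix (Fin 2) (Fin 2) (ZMod 3)) = 2) : A ^ 3 = 1 := by
  set M : Matrix (Fin 2) (Fin 2) (ZMod 3) := (A : Matrix (Fin 2) (Fin 2) (ZMod 3)) with hM
  rw [Matrix.det_fin_two] at hdet
  rw [Matrix.trace_fin_two] at htr
  obtain ⟨h00, h01, h10, h11⟩ :=
    entries_cube_of_det_eq_one_of_trace_eq_two (M 0 0) (M 0 1) (M 1 0) (M 1 1) hdet htr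
  apply Units.ext
  rw [Units.val_pow_eq_pow_val, Units.val_one, pow_succ, sq, ← hM]
  ext i j
  fin_cases i <;> fin_cases j <;>
    simp only [Matrix.mul_apply, Fin.sum_univ_two, Matrix.one_apply, Fin.isValue, Fin.zero_eta, Fin.mk_one,
      if_true, one_ne_zero, zero_ne_one, if_false] <;>
    first | exact h00 | exact h01 | exact h10 | exact h11

/-- **In a subgroup `G ≤ GL₂(𝔽₃)` of order prime to `3`, a non-trivial element of determinant `1` is `−1` or has square `−1`**
(the `2`-subgroups of `SL₂(𝔽₃)` lie in `Q₈`, whose non-central elements all have square `−1`). Proof by trace: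
`tr A = 0 ⟹ A² = −1`; `tr A = 1 ⟹ A³ = −1`, so `A²` is killed by `3`, hence trivial (else of order `3 ∣ #G`), and then
`A = A³ = −1`; `tr A = −1 ⟹ A³ = 1`, so `A` has order `3 ∣ #G` — excluded. [cite: Serre1972, §2.4 Prop. 15, §2.5–2.6] -/
theorem eq_neg_one_or_sq_eq_neg_one_of_det_eq_one {G : Subgroup (GL (Fin 2) (ZMod 3))}
    (hG : ¬ 3 ∣ Nat.card G) {A : GL (Fin 2) (ZMod 3)} (hA : A ∈ G)
    (hdet : Matrix.det (A : Matrix (Fin 2) (Fin 2) (ZMod 3)) = 1) (h1 : A ≠ 1) :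
    A = -1 ∨ A ^ 2 = -1 := by
  -- an element of `G` of order `3` would make `3 ∣ #G`
  have hord : ∀ B : GL (Fin 2) (ZMod 3), B ∈ G → B ^ 3 = 1 → B = 1 := by
    intro B hB hB3
    by_contra hB1
    have h3 : orderOf B = 3 := orderOf_eq_prime hB3 hB1
    apply hG
    have hdvd : orderOf (⟨B, hB⟩ : G) ∣ Nat.card G := orderOf_dvd_natCard _
    rw [Subgroup.orderOf_mk, h3] at hdvd
    exact hdvd
  set t : ZMod 3 := Matrix.trace (A : Matrix (Fin 2) (Fin 2) (ZMod 3)) with ht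
  rcases (by decide : ∀ s : ZMod 3, s = 0 ∨ s = 1 ∨ s = 2) t with h0 | h1' | h2
  · exact Or.inr (sq_eq_neg_one_of_det_eq_one_of_trace_eq_zero hdet h0)
  · left
    have h3 := cube_eq_neg_one_of_det_eq_one_of_trace_eq_one hdet h1'
    have hsq : (A ^ 2) ^ 3 = 1 := by
      rw [← pow_mul, show 2 * 3 = 3 + 3 from rfl, pow_add, h3, neg_mul_neg, one_mul]
    have hA2 : A ^ 2 = 1 := hord (A ^ 2) (G.pow_mem hA 2) hsq
    calc A = A ^ 3 * (A ^ 2)⁻¹ := by group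
      _ = -1 := by rw [h3, hA2, inv_one, mul_one]
  · exact absurd (hord A hA (cube_eq_one_of_det_eq_one_of_trace_eq_two hdet h2)) h1

/-! ### §2. On `E[3]`: a non-trivial commutator of `ρ̄_{E,3}(Γ_ℚ)` is `−1` or has square `−1` -/

variable (W : WeierstrassCurve ℚ) [W.IsElliptic]

/-- **A non-trivial commutator of the mod-`3` image acts as `−1`, or its square does.** For `E = W/ℚ` with `E[3]` irreducible
and `ρ̄_{E,3}` not onto, and `a, b ∈ Γ_ℚ` with `ρ̄(ab) ≠ ρ̄(ba)`: the commutator `c = a b a⁻¹ b⁻¹` satisfies `c • P = −P` for every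
`P ∈ E[3]`, or `c² • P = −P` for every `P ∈ E[3]`. (In the tree's frame `(e, Φ)` of `E[3]`: `A = Φ(ρ̄ c)` has `det A = 1`, `A ≠ 1`,
and lies in `G = Φ(ρ̄(Γ_ℚ))` with `3 ∤ #G` (`not_dvd_card_of_not_hasSurjectiveModNGaloisRep`); §1.) [cite: Serre1972, §2.4 Prop. 15, §2.5–2.6, §5.4] -/
theorem smul_eq_neg_or_sq_smul_eq_neg_of_commutator [Fact (Nat.Prime 3)]
    (hirr : W.HasIrreducibleModPGaloisRep 3) (hns : ¬ W.HasSurjectiveModNGaloisRep 3)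
    {a b : absoluteGaloisGroup ℚ}
    (hab : galoisRepTorsion W (3 : ℕ) (a * b) ≠ galoisRepTorsion W (3 : ℕ) (b * a)) :
    (∀ P : geomTorsion W (3 : ℕ), (a * b * a⁻¹ * b⁻¹) • P = -P) ∨
      (∀ P : geomTorsion W (3 : ℕ), ((a * b * a⁻¹ * b⁻¹) * (a * b * a⁻¹ * b⁻¹)) • P = -P) := by
  obtain ⟨e, Φ, he, -, hdetχ, -⟩ := exists_frame_galoisRepTorsion_rat W 3
  set ρ := galoisRepTorsion W (3 : ℕ) with hρ
  set G : Subgroup (GL (Fin 2) (ZMod 3)) := ρ.range.map Φ.toMonoidHom with hGdef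
  have hG : ¬ 3 ∣ Nat.card G := W.not_dvd_card_of_not_hasSurjectiveModNGaloisRep 3 Φ e he hirr hns
  set c : absoluteGaloisGroup ℚ := a * b * a⁻¹ * b⁻¹ with hc
  set A : GL (Fin 2) (ZMod 3) := Φ (ρ c) with hAdef
  have hA : A ∈ G := Subgroup.mem_map.mpr ⟨ρ c, ⟨c, rfl⟩, rfl⟩
  -- `det A = 1`: the determinant of a commutator in the commutative group `𝔽₃ˣ`
  have hdetu : Matrix.GeneralLinearGroup.det A = 1 := by
    rw [hAdef, hc, map_mul, map_mul, map_mul, map_inv, map_inv, map_mul, map_mul, map_mul, map_inv, map_inv,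
      map_mul, map_mul, map_mul, map_inv, map_inv]
    set x := Matrix.GeneralLinearGroup.det (Φ (ρ a))
    set y := Matrix.GeneralLinearGroup.det (Φ (ρ b))
    have : x * y * x⁻¹ * y⁻¹ = (x * x⁻¹) * (y * y⁻¹) := by
      rw [mul_comm x y, mul_assoc, mul_assoc, ← mul_assoc x, mul_inv_cancel, one_mul, one_mul]
    rw [this, mul_inv_cancel, mul_inv_cancel, one_mul]
  have hdet : Matrix.det (A : Matrix (Fin 2) (Fin 2) (ZMod 3)) = 1 := by
    rw [← Matrix.GeneralLinearGroup.val_det_apply, hdetu, Units.val_one]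
  -- `A ≠ 1`
  have h1 : A ≠ 1 := by
    intro hA1
    apply hab
    have hρc : ρ c = 1 := Φ.injective (by rw [map_one]; exact hA1)
    have hcomm : ρ a * ρ b * (ρ a)⁻¹ * (ρ b)⁻¹ = 1 := by
      rw [← map_inv, ← map_inv, ← map_mul, ← map_mul, ← map_mul]; exact hρc
    rw [map_mul, map_mul]
    calc ρ a * ρ b = ρ a * ρ b * (ρ a)⁻¹ * (ρ b)⁻¹ * (ρ b * ρ a) := by group
      _ = ρ b * ρ a := by rw [hcomm, one_mul]
  -- the matrix side: `A = -1` or `A² = -1`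
  have hmat := eq_neg_one_or_sq_eq_neg_one_of_det_eq_one hG hA hdet h1
  -- translating `Φ (ρ g) = -1` into `g • P = -P`
  have key : ∀ g : absoluteGaloisGroup ℚ, Φ (ρ g) = -1 → ∀ P : geomTorsion W (3 : ℕ), g • P = -P := by
    intro g hg P
    have h := he (ρ g) P
    rw [hg, Units.val_neg, Units.val_one, Matrix.neg_mulVec, Matrix.one_mulVec, ← map_neg] at h
    have h' : Multiplicative.toAdd (ρ g) P = -P := e.injective h
    rw [← h', hρ, galoisRepTorsion_apply]
  rcases hmat with hneg | hsq
  · exact Or.inl (key c hneg)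
  · right
    refine key (c * c) ?_
    rw [map_mul, map_mul, ← sq]
    exact hsq

end Summit.BirchSwinnertonDyer.BirchSwinnertonDyer.Theorems.ChebKummerThree

end
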